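/-
Origin: expansion seat `planner-pub-hodgecm-pv09-g4-0`, handover #4 2026-08-18T07:18:08Z (`HOME/pub-hodgecm-pv09-g4/lean/Pv09g4/IdelicTorusDomain.lean`, md5 d834c19c, 109 lines);
landed by the gen-7 packager in gate run 25 as `HodgeCM/PerL34/IdelicTorusDomain.lean` (import ^import Pv[0-9]+g[0-9]+\.→import HodgeCM.PerL34. ×2).
-/
/-
HodgeCM / PerL34 publication cell — seams S3 / S5 support (pub-hodgecm-pv09-g4, HANDOVER #4).
Imports: `Pv11g4.NormOneRelTorus` = byte MIRROR of pv11-g4's run-25 file (md5 bafc96bc83d6; DO NOT LAND from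
this directory) ↦ `HodgeCM.PerL34.NormOneRelTorus`, and `Pv09g4.CocompactFundamentalDomain` (HANDOVER #3)
↦ `HodgeCM.PerL34.CocompactFundamentalDomain`.  Complete proofs, no new axioms, nothing cited.
-/
import Summits.HodgeConjecture.HodgeCM.PerL34.NormOneRelTorus_2
import Summits.HodgeConjecture.HodgeCM.PerL34.CocompactFundamentalDomain

/-!
# A fundamental domain of `[U(W_j)] = L¹ \ U(1)_{L/K}(𝔸_K)` in the idelic model

pv11-g4 (`NormOneRelTorus.lean`) constructs the genuine automorphic torus of a hermitian line:
`relNormOneIdeles K L ≤ 𝔸_L^×` (`U(1)_{L/K}(𝔸_K)`), its rational points `relNormOneRat K L` (`= L¹`),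
and proves `DiscreteTopology (relNormOneRat K L)`, `CompactSpace (relNormOneIdeles K L ⧸ relNormOneRat K L)`,
`LocallyCompactSpace (relNormOneIdeles K L)` in the kernel.  With the general existence theorem of
`CocompactFundamentalDomain.lean` this gives, for EVERY measure on `U(1)(𝔸_K)` finite on compact sets (every
Haar measure), a measurable, relatively compact fundamental domain `𝓕` of `L¹` of finite measure — the set the
Petersson / theta-kernel integrals "`∫_{[U(W_j)]} … du`" of PerL v5 §3.2 (tex l. 264) and §4.2 (tex l. 590) are
taken over — for the left action and for the right action (`(relNormOneRat K L).op`):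

* `countable_of_numberField`, `countable_units_of_numberField`, `countable_principalIdeles`,
  `countable_relNormOneRat` — `L`, `L^×`, the principal ideles and `L¹` are countable;
* `exists_isFundamentalDomain_relNormOneRat` / `_op` — the fundamental domains;
* `hasFundamentalDomain_relNormOneRat_op` — Mathlib's `HasFundamentalDomain` for the right action.

The Borel σ-algebra on `relNormOneIdeles K L` is taken as an instance ARGUMENT (`[MeasurableSpace _]
[BorelSpace _]`), not registered here, so that no instance of pv11-g4's types is pre-empted.
-/

set_option autoImplicit false

noncomputable section

open MeasureTheory Set Topology

namespace HodgeCM.PerL34.DiscreteFD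

open NumberField

section Countable

variable (L : Type) [Field L] [NumberField L]

/-- A number field is countable (it is `ℚ^n`). -/
theorem countable_of_numberField : Countable L :=
  (Module.finBasis ℚ L).repr.injective.countable

/-- The multiplicative group of a number field is countable. -/
theorem countable_units_of_numberField : Countable Lˣ :=
  haveI := countable_of_numberField L
  Units.val_injective.countable

/-- The principal ideles `L^× ≤ 𝔸_L^×` are countable. -/
instance countable_principalIdeles : Countable (principalIdeles L) := by
  haveI := countable_units_of_numberField L
  unfold principalIdeles
  exact Set.countable_range _ |>.to_subtype

variable (K : Type) [Field K] [Algebra K L] [FiniteDimensional K L]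

/-- The rational points `L¹ = U(1)_{L/K}(K)` of the relative norm-one torus are countable. -/
instance countable_relNormOneRat : Countable (relNormOneRat K L) := by
  haveI := countable_principalIdeles L
  refine (Function.Injective.countable (f := fun a : relNormOneRat K L =>
    (⟨((a : relNormOneIdeles K L) : ideleGroup L), a.2⟩ : principalIdeles L)) ?_)
  intro a b h
  have h' := congrArg Subtype.val h
  exact Subtype.ext (Subtype.ext h')

end Countable

section Domain

variable (K L : Type) [Field K] [Field L] [NumberField L] [Algebra K L] [FiniteDimensional K L]
  [MeasurableSpace (relNormOneIdeles K L)] [BorelSpace (relNormOneIdeles K L)]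

/-- **Fundamental domain of `L¹` in `U(1)_{L/K}(𝔸_K)`, left action**: for every measure finite on compact
sets there is a measurable, relatively compact fundamental domain of finite measure. -/
theorem exists_isFundamentalDomain_relNormOneRat (μ : Measure (relNormOneIdeles K L))
    [IsFiniteMeasureOnCompacts μ] :
    ∃ 𝓕 : Set (relNormOneIdeles K L), MeasurableSet 𝓕 ∧
      IsFundamentalDomain (relNormOneRat K L) 𝓕 μ ∧ IsCompact (closure 𝓕) ∧ μ 𝓕 < ⊤ :=
  exists_isFundamentalDomain_left_finite' (relNormOneRat K L) μ

/-- **Fundamental domain of `L¹` in `U(1)_{L/K}(𝔸_K)`, right action (`L¹.op`)**. -/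
theorem exists_isFundamentalDomain_relNormOneRat_op (μ : Measure (relNormOneIdeles K L))
    [IsFiniteMeasureOnCompacts μ] :
    ∃ 𝓕 : Set (relNormOneIdeles K L), MeasurableSet 𝓕 ∧
      IsFundamentalDomain (relNormOneRat K L).op 𝓕 μ ∧ IsCompact (closure 𝓕) ∧ μ 𝓕 < ⊤ :=
  exists_isFundamentalDomain_op_finite' (relNormOneRat K L) μ

/-- The exact form: a measurable relatively compact `𝓕` containing exactly one point of every `L¹`-orbit
(so a fundamental domain for every measure at once). -/
theorem exists_fundamentalDomain_relNormOneRat_exact :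
    ∃ 𝓕 : Set (relNormOneIdeles K L), MeasurableSet 𝓕 ∧ IsCompact (closure 𝓕) ∧
      ∀ x : relNormOneIdeles K L, ∃! γ : relNormOneRat K L, γ • x ∈ 𝓕 :=
  exists_fundamentalDomain_left_relCompact' (relNormOneRat K L)

/-- `HasFundamentalDomain` for the right action of `L¹` on `U(1)(𝔸_K)`, any measure. -/
theorem hasFundamentalDomain_relNormOneRat_op (μ : Measure (relNormOneIdeles K L)) :
    HasFundamentalDomain (relNormOneRat K L).op (relNormOneIdeles K L) μ :=
  hasFundamentalDomain_op' (relNormOneRat K L) μ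

end Domain

end HodgeCM.PerL34.DiscreteFD

end
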